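import Mathlib
import HarnessLib
import Summits.NavierStokesRegularity.NavierStokesRegularity.Theorems.PoloidalWindowDoorPoloidalWindowRigiditySparseEnergyPlaneMeans

/-!
# Route `PoloidalWindowDoor`, crux `PoloidalWindowRigidity` (stmt-19708), line `sparse_energy` —
# plane means of `|v|²` vanish UNIFORMLY IN TIME away from the apex (the form rung R2 consumes)

Seat ns-poloidal-K2-p2 g8 (interim LEAD-of-record on 19708; file `--supports`).  Companion of `…SparseEnergyPlaneMeans`
(stub S3 `stub_planeMeansVanish`, p610089): the same slab-average argument, run with the slice-independent constants
`M₀ = C/√(−t₁)`, `M₁ = C₁/(−t₁)` valid for every `t ≤ t₁ < 0`, gives ONE threshold `R₀(φ, t₁, ε)` for all earlier times: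

* `exists_hmean_normSq_le` — the core estimate, for ONE vector field `w : ℝ³ → ℝ³` with `‖w‖ ≤ M₀`, `‖Dw‖ ≤ M₁` and ball energies
  `≤ K R`: `hmean φ c R z |w|² ≤ A(φ, M₀, M₁, K)/√R` for `R ≥ 1`, all centres and heights;
* `planeMeansVanish_uniform` — for a profile of the route's Type-I class with bounded scale-invariant energy:
  `∀ t₁ < 0, ∀ ε > 0, ∃ R₀, ∀ R ≥ R₀, ∀ t ≤ t₁, ∀ c z, hmean φ c R z |v(t)|² ≤ ε`.

Rung R2 of the line («plane means ⇒ the (TH) pressure datum `A ≡ 0`», design in CENSUS-19708-K2p2-g8 §5) integrates the plane mean of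
the scalar law E over a time interval `[t', t] ⊆ (−∞, t₁]`; the uniform threshold is what lets every term go to `0` under the integral.

WHAT THIS IS NOT: not a claim about Navier–Stokes regularity — an a-priori estimate inside the line `sparse_energy`
(bears_on LADDER-NS N0 via crux 19708).
-/

noncomputable section

-- the summit and its single sub-problem share the name (CONVENTIONS §1), as in every Theorems file
set_option linter.dupNamespace false

namespace Summit.NavierStokesRegularity.NavierStokesRegularity.Theorems.PoloidalWindowDoorPoloidalWindowRigiditySparseEnergyPlaneMeansUniform

open MeasureTheory Set Function Filter Topology Metric
open scoped RealInnerProductSpace InnerProductSpace ENNReal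
open Literature.Analysis Literature.Analysis.FluidPDE
open Summit.NavierStokesRegularity.NavierStokesRegularity.Theorems.PoloidalWindowDoorPoloidalWindowRigidityHorizontalMean
open Summit.NavierStokesRegularity.NavierStokesRegularity.Theorems.PoloidalWindowDoorPoloidalWindowRigiditySparseEnergySlabMean
open Summit.NavierStokesRegularity.NavierStokesRegularity.Theorems.PoloidalWindowDoorPoloidalWindowRigiditySparseEnergyPlaneMeans
open Summit.NavierStokesRegularity.NavierStokesRegularity.Theorems.PoloidalWindowDoorPoloidalWindowRigidityClassRate
open Summit.NavierStokesRegularity.NavierStokesRegularity.Theorems.PoloidalWindowDoorPoloidalWindowRigidityClebsch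

/-! ### The core estimate for one vector field -/

/-- **Core estimate.**  For a bump `φ` and constants `M₀, M₁, K ≥ 0` there is `A ≥ 0` such that every differentiable `w : ℝ³ → ℝ³` with
`‖w‖ ≤ M₀`, `‖Dw‖ ≤ M₁` and `∫_{B_R(a)} |w|² ≤ K R` for all balls satisfies `hmean φ c R z |w|² ≤ A/√R` for all `R ≥ 1`, `c`, `z`
(vertical window `h = R^{-1/2}`, `…SparseEnergySlabMean.setIntegral_window_le_ball`). [folklore] -/
theorem exists_hmean_normSq_le (φ : ContDiffBump (0 : EuclideanSpace ℝ (Fin 2))) {M₀ M₁ K : ℝ}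
    (hM₀ : 0 ≤ M₀) (hM₁ : 0 ≤ M₁) (hK0 : 0 ≤ K) :
    ∃ A : ℝ, 0 ≤ A ∧ ∀ (w : EuclideanSpace ℝ (Fin 3) → EuclideanSpace ℝ (Fin 3)), Differentiable ℝ w →
      (∀ x, ‖w x‖ ≤ M₀) → (∀ x, ‖fderiv ℝ w x‖ ≤ M₁) →
      (∀ (a : EuclideanSpace ℝ (Fin 3)) (ρ : ℝ), 0 < ρ →
        (∫⁻ x in Metric.ball a ρ, ENNReal.ofReal (‖w x‖ ^ 2)) ≤ ENNReal.ofReal (K * ρ)) →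
      ∀ R : ℝ, 1 ≤ R → ∀ (c : EuclideanSpace ℝ (Fin 3)) (z : ℝ),
        hmean φ c R z (fun x => ‖w x‖ ^ 2) ≤ A / Real.sqrt R := by
  -- the bump: bounded by `Φ`, supported in the closed disc of radius `r = φ.rOut`
  obtain ⟨Φ, hΦ⟩ := (φ.hasCompactSupport_normed (μ := volume)).exists_bound_of_continuous φ.continuous_normed
  have hΦ0 : 0 ≤ Φ := le_trans (norm_nonneg _) (hΦ 0)
  set r : ℝ := φ.rOut with hr
  have hr0 : 0 < r := φ.rOut_pos
  set L : ℝ := 2 * M₀ * M₁ with hL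
  have hL0 : 0 ≤ L := by positivity
  refine ⟨Φ * K * (r + 1) / 2 + L, by positivity, ?_⟩
  intro w hdiff hwM hDwM hball R hR1 c z
  have hR0 : 0 < R := lt_of_lt_of_le one_pos hR1
  set F : EuclideanSpace ℝ (Fin 3) → ℝ := fun x => ‖w x‖ ^ 2 with hF
  have hFc : Continuous F := (hdiff.continuous.norm).pow 2
  have hF0 : ∀ x, 0 ≤ F x := fun x => by positivity
  have hLip : ∀ (x : EuclideanSpace ℝ (Fin 3)) (s : ℝ), |F (x + s • EuclideanSpace.single 2 1) - F x| ≤ L * |s| :=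
    fun x s => abs_normSq_vertical_sub_le hdiff hM₀ hwM hDwM x s
  set q : ℝ := Real.sqrt R with hq
  have hq0 : 0 < q := Real.sqrt_pos.2 hR0
  have hq1 : 1 ≤ q := by rw [hq]; exact Real.one_le_sqrt.2 hR1
  have hqR : q ^ 2 = R := Real.sq_sqrt hR0.le
  set h : ℝ := q⁻¹ with hh
  have hh0 : 0 < h := inv_pos.2 hq0
  have hh1 : h ≤ 1 := inv_le_one_of_one_le₀ hq1
  have hhR : h ≤ R := le_trans hh1 hR1
  -- Step 1: `F` is below its vertical window average, pointwise, hence in the mean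
  set W : EuclideanSpace ℝ (Fin 3) → ℝ := fun x => ∫ s in Icc (-h) h, F (x + s • EuclideanSpace.single 2 1) with hW
  have hWc : Continuous W := by
    have hu : Continuous (Function.uncurry fun (x : EuclideanSpace ℝ (Fin 3)) (s : ℝ) =>
        F (x + s • EuclideanSpace.single 2 1)) :=
      hFc.comp (continuous_fst.add (continuous_snd.smul continuous_const))
    exact continuous_parametric_integral_of_continuous hu isCompact_Icc
  have hFG : ∀ x, F x ≤ (2 * h)⁻¹ * W x + L * h := fun x => le_verticalAverage_add hFc x (hLip x) hh0
  have hc1 : Continuous fun x => (2 * h)⁻¹ * W x := continuous_const.mul hWc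
  have hGc : Continuous fun x => (2 * h)⁻¹ * W x + L * h := hc1.add continuous_const
  have hstep1 : hmean φ c R z F ≤ (2 * h)⁻¹ * hmean φ c R z W + L * h := by
    have h1 := hmean_mono φ c R z hFc hGc hFG
    rwa [hmean_add φ c R z hc1 continuous_const, hmean_const_mul φ c R z, hmean_const φ c R z] at h1
  -- Step 2: the mean of the window integral against the bump is a window of plane integrals over the disc
  have hW0 : ∀ y : EuclideanSpace ℝ (Fin 2), 0 ≤ W (pt c R z y) := fun y =>
    setIntegral_nonneg measurableSet_Icc fun s _ => hF0 _
  have hWpt : Continuous fun y : EuclideanSpace ℝ (Fin 2) => W (pt c R z y) := hWc.comp (continuous_pt c R z)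
  have hle : ∀ y : EuclideanSpace ℝ (Fin 2), W (pt c R z y) * φ.normed volume y ≤
      Φ * (closedBall (0 : EuclideanSpace ℝ (Fin 2)) r).indicator (fun y => W (pt c R z y)) y := by
    intro y
    by_cases hy : y ∈ closedBall (0 : EuclideanSpace ℝ (Fin 2)) r
    · rw [indicator_of_mem hy]
      have hb := hΦ y
      rw [Real.norm_of_nonneg (φ.nonneg_normed y)] at hb
      calc W (pt c R z y) * φ.normed volume y ≤ W (pt c R z y) * Φ := mul_le_mul_of_nonneg_left hb (hW0 y)
        _ = Φ * W (pt c R z y) := mul_comm _ _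
    · have hzero : φ.normed volume y = 0 := by
        have hy' : y ∉ tsupport (φ.normed volume) := by rw [φ.tsupport_normed_eq]; exact hy
        exact image_eq_zero_of_notMem_tsupport hy'
      rw [hzero, mul_zero, indicator_of_notMem hy, mul_zero]
  have hstep2 : hmean φ c R z W ≤ Φ * ∫ y in closedBall (0 : EuclideanSpace ℝ (Fin 2)) r, W (pt c R z y) := by
    show ∫ y, W (pt c R z y) * φ.normed volume y ≤ _
    have hi1 : Integrable fun y => W (pt c R z y) * φ.normed volume y := integrable_mul_normed φ hWpt
    have hi2 : Integrable fun y => Φ * (closedBall (0 : EuclideanSpace ℝ (Fin 2)) r).indicator (fun y => W (pt c R z y)) y :=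
      ((hWpt.continuousOn.integrableOn_compact (isCompact_closedBall _ _)).integrable_indicator
        measurableSet_closedBall).const_mul Φ
    calc ∫ y, W (pt c R z y) * φ.normed volume y
        ≤ ∫ y, Φ * (closedBall (0 : EuclideanSpace ℝ (Fin 2)) r).indicator (fun y => W (pt c R z y)) y :=
          integral_mono hi1 hi2 hle
      _ = Φ * ∫ y in closedBall (0 : EuclideanSpace ℝ (Fin 2)) r, W (pt c R z y) := by
          rw [integral_const_mul, integral_indicator measurableSet_closedBall]
  -- Step 3: the window of plane integrals is controlled by a ball, whose energy is `≤ K (R r + h)`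
  have hstep3 : ∫ y in closedBall (0 : EuclideanSpace ℝ (Fin 2)) r, W (pt c R z y) ≤
      (R ^ 2)⁻¹ * ∫ x in ball (c + z • EuclideanSpace.single 2 1) (R * r + h), F x :=
    setIntegral_window_le_ball hFc hF0 c hR0 z hr0 hh0
  have hρ : 0 < R * r + h := by positivity
  have hballF : ∫ x in ball (c + z • EuclideanSpace.single 2 1) (R * r + h), F x ≤ K * (R * r + h) := by
    have hKb := hball (c + z • EuclideanSpace.single 2 1) (R * r + h) hρ
    have hint : IntegrableOn F (ball (c + z • EuclideanSpace.single 2 1) (R * r + h)) :=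
      (hFc.continuousOn.integrableOn_compact (isCompact_closedBall _ _)).mono_set ball_subset_closedBall
    rw [integral_eq_lintegral_of_nonneg_ae (ae_of_all _ fun x => hF0 x) hint.aestronglyMeasurable]
    exact ENNReal.toReal_le_of_le_ofReal (by positivity) hKb
  -- Step 4: arithmetic with `h = R^{-1/2}`
  have hwin : (R ^ 2)⁻¹ * (K * (R * r + h)) ≤ K * (r + 1) / q ^ 2 := by
    rw [hqR]
    have h1 : K * (R * r + h) ≤ K * (R * (r + 1)) := by
      apply mul_le_mul_of_nonneg_left _ hK0; nlinarith
    calc (R ^ 2)⁻¹ * (K * (R * r + h)) ≤ (R ^ 2)⁻¹ * (K * (R * (r + 1))) :=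
          mul_le_mul_of_nonneg_left h1 (inv_nonneg.2 (sq_nonneg R))
      _ = K * (r + 1) / R := by field_simp
  have hmeanW : hmean φ c R z W ≤ Φ * (K * (r + 1) / q ^ 2) := by
    calc hmean φ c R z W ≤ Φ * ∫ y in closedBall (0 : EuclideanSpace ℝ (Fin 2)) r, W (pt c R z y) := hstep2
      _ ≤ Φ * ((R ^ 2)⁻¹ * ∫ x in ball (c + z • EuclideanSpace.single 2 1) (R * r + h), F x) :=
          mul_le_mul_of_nonneg_left hstep3 hΦ0
      _ ≤ Φ * ((R ^ 2)⁻¹ * (K * (R * r + h))) := by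
          apply mul_le_mul_of_nonneg_left _ hΦ0
          exact mul_le_mul_of_nonneg_left hballF (inv_nonneg.2 (sq_nonneg R))
      _ ≤ Φ * (K * (r + 1) / q ^ 2) := mul_le_mul_of_nonneg_left hwin hΦ0
  have h2h : 0 ≤ (2 * h)⁻¹ := by positivity
  calc hmean φ c R z F ≤ (2 * h)⁻¹ * hmean φ c R z W + L * h := hstep1
    _ ≤ (2 * h)⁻¹ * (Φ * (K * (r + 1) / q ^ 2)) + L * h := by
        have := mul_le_mul_of_nonneg_left hmeanW h2h; linarith
    _ = (Φ * K * (r + 1) / 2 + L) / q := by rw [hh]; field_simp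

/-! ### Uniform-in-time plane means for the class -/

/-- **Plane means of `|v(t)|²` vanish uniformly in `t ≤ t₁ < 0`.**  For a profile of the route's Type-I class (rate `C`, continuous,
Oseen-mild) whose scale-invariant energy is bounded by `K·R` on every ball at every negative time, for every bump `φ`, every
`t₁ < 0` and every `ε > 0` there is `R₀ > 0` with `hmean φ c R z |v(t)|² ≤ ε` for all `R ≥ R₀`, all `t ≤ t₁`, all centres `c` and
heights `z` (the constants `C/√(−t)`, `C₁/(−t)` of the slice bounds are monotone in `t`). [folklore] -/
theorem planeMeansVanish_uniform {C : ℝ} {v : ℝ → EuclideanSpace ℝ (Fin 3) → EuclideanSpace ℝ (Fin 3)}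
    (hrate : HasTypeITimeDecay C v) (hcont : ContinuousOn (Function.uncurry v) (Set.Iio (0 : ℝ) ×ˢ Set.univ))
    (hmild : ∀ s t : ℝ, s < t → t < 0 → ∀ x, v t x =
      UnboundedOperators.heatExtension (v s) (t - s) x - oseenDuhamel 1 s v v t x)
    {K : ℝ} (hK0 : 0 ≤ K)
    (hK : ∀ t₀ : ℝ, t₀ < 0 → ∀ (a : EuclideanSpace ℝ (Fin 3)) (R : ℝ), 0 < R →
      (∫⁻ x in Metric.ball a R, ENNReal.ofReal (‖v t₀ x‖ ^ 2)) ≤ ENNReal.ofReal (K * R))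
    (φ : ContDiffBump (0 : EuclideanSpace ℝ (Fin 2))) {t₁ : ℝ} (ht₁ : t₁ < 0) {ε : ℝ} (hε : 0 < ε) :
    ∃ R₀ : ℝ, 0 < R₀ ∧ ∀ R : ℝ, R₀ ≤ R → ∀ t : ℝ, t ≤ t₁ → ∀ (c : EuclideanSpace ℝ (Fin 3)) (z : ℝ),
      hmean φ c R z (fun x => ‖v t x‖ ^ 2) ≤ ε := by
  -- slice bounds, uniform in `t ≤ t₁`
  have ht₁' : 0 < -t₁ := neg_pos.2 ht₁
  have hC0 : 0 ≤ C := by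
    have h := hrate t₁ ht₁ 0
    have hs : 0 < Real.sqrt (-t₁) := Real.sqrt_pos.2 ht₁'
    by_contra hC
    have : C / Real.sqrt (-t₁) < 0 := div_neg_of_neg_of_pos (lt_of_not_ge hC) hs
    linarith [norm_nonneg (v t₁ 0)]
  obtain ⟨C₁, hC₁⟩ := exists_fderiv_rate_of_class hrate hcont hmild
  have hC₁0 : 0 ≤ C₁ := by
    have h := hC₁ t₁ ht₁ 0
    by_contra hC
    have : C₁ / (-t₁) < 0 := div_neg_of_neg_of_pos (lt_of_not_ge hC) ht₁'
    linarith [norm_nonneg (fderiv ℝ (v t₁) 0)]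
  set M₀ : ℝ := C / Real.sqrt (-t₁) with hM₀
  set M₁ : ℝ := C₁ / (-t₁) with hM₁
  have hM₀0 : 0 ≤ M₀ := by positivity
  have hM₁0 : 0 ≤ M₁ := by positivity
  have hvM : ∀ t ≤ t₁, ∀ x, ‖v t x‖ ≤ M₀ := by
    intro t ht x
    have ht0 : t < 0 := lt_of_le_of_lt ht ht₁
    refine (hrate t ht0 x).trans ?_
    rw [hM₀]
    exact div_le_div_of_nonneg_left hC0 (Real.sqrt_pos.2 ht₁') (Real.sqrt_le_sqrt (by linarith))
  have hDvM : ∀ t ≤ t₁, ∀ x, ‖fderiv ℝ (v t) x‖ ≤ M₁ := by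
    intro t ht x
    have ht0 : t < 0 := lt_of_le_of_lt ht ht₁
    refine (hC₁ t ht0 x).trans ?_
    rw [hM₁]
    exact div_le_div_of_nonneg_left hC₁0 ht₁' (by linarith)
  obtain ⟨A, hA0, hA⟩ := exists_hmean_normSq_le φ hM₀0 hM₁0 hK0
  refine ⟨max 1 ((A / ε) ^ 2 + 1), lt_max_of_lt_left one_pos, fun R hR t ht c z => ?_⟩
  have hR1 : 1 ≤ R := le_trans (le_max_left _ _) hR
  have hR0 : 0 < R := lt_of_lt_of_le one_pos hR1
  have hRA : (A / ε) ^ 2 + 1 ≤ R := le_trans (le_max_right _ _) hR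
  have ht0 : t < 0 := lt_of_le_of_lt ht ht₁
  have hdiff : Differentiable ℝ (v t) := (contDiff_slice hrate hcont hmild ht0).differentiable (by simp)
  have hkey := hA (v t) hdiff (hvM t ht) (hDvM t ht) (fun a ρ hρ => hK t ht0 a ρ hρ) R hR1 c z
  have hq0 : 0 < Real.sqrt R := Real.sqrt_pos.2 hR0
  have hlt : A / ε < Real.sqrt R := by
    calc A / ε = Real.sqrt ((A / ε) ^ 2) := (Real.sqrt_sq (div_nonneg hA0 hε.le)).symm
      _ < Real.sqrt R := Real.sqrt_lt_sqrt (sq_nonneg _) (by linarith)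
  have hfin : A / Real.sqrt R ≤ ε := by
    rw [div_le_iff₀ hq0]
    have := (div_lt_iff₀ hε).1 hlt
    linarith
  exact hkey.trans hfin

end Summit.NavierStokesRegularity.NavierStokesRegularity.Theorems.PoloidalWindowDoorPoloidalWindowRigiditySparseEnergyPlaneMeansUniform

end
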